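import Literature.NumberTheory.Automorphic.SchwartzBruhatL2Unitarizable          -- ★ (B-p12 (g26)): `Representation.IsL2Isometric.isUnitarizable` — the `L²` pairing is an invariant positive-definite Hermitian form
import Literature.NumberTheory.GelbartRogawski1991.UndoubledSplittingsUnitary     -- ★ `isL2Isometric_omegaLoc_congrW_undoubledSplittings_cmFinLocalFamily` (`θ` unitary ⇒ `ω_v` is `L²`-isometric)
import Literature.NumberTheory.GelbartRogawski1991.CMThetaTypeVocabulary         -- ★ (V) `chiLocalSplittingsCM` = `congrW … (undoubledSplittings … (cmFinLocalFamily θ …))` (reducible), ★ `borelPlaceMeasure`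
import HarnessLib

/-!
# Crux `H413` — programme P3b, line L1′ «KeysPnUnitary», STUB U1a′: the local Weil representation `ω_v` of the CM splitting package is UNITARIZABLE

Cell `hodgecm-mathlib`, crux H413 (`stmt-HodgeConjecture-24833`), registered pay-down line `Cruxes/H413/Lines/F0_P3b_KeysPnUnitaryPaydown.lean` (ED. 2
6b92d689b217ef7c), stub `stub_isUnitarizable_omegaLocCM` :118 (U1a′, in-house; director s618 (1) deal to B-p12 (g26)).  PROOF lane: no `def`, no `sorry`,
no named fact; `--supports stmt-HodgeConjecture-24833`.  The head below has the stub's binders and conclusion TOKEN FOR TOKEN, so the line's ED. 3 hunk is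
`theorem stub_isUnitarizable_omegaLocCM … := F0P3bOmegaLocUnitarizable.isUnitarizable_omegaLoc_chiLocalSplittingsCM L e₁ dV hdV hdV0 θ hθ hθu ε v`.

THE MATHEMATICS [MoeglinVignerasWaldspurger1987 Chap. 2 II.1–II.2; Kudla1994 §1, Thm 3.1; GelbartRogawski1991 §3.1 Prop. 3.1.1 p. 455].  The package
★ `chiLocalSplittingsCM L e₁ dV hdV hdV0 θ hθ ε` is (reducibly) the END-display family `congrW … (undoubledSplittings … (cmFinLocalFamily θ …))` of local
splittings of the CM dual pair `(U(diag dV), U(ε))`, whose local Weil representation `ω_v` acts on the Schrödinger model `𝒮((L⁺_v)ⁿ′)` (locally constant,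
compactly supported functions).  For a UNITARY splitting character `θ`, Kudla's normalising function has modulus one and the Leray–Rao operators are
`L²`-isometries for any Haar measure, so `ω_v` is `L²((L⁺_v)ⁿ′, μ′ⁿ′)`-ISOMETRIC (★ `isL2Isometric_omegaLoc_congrW_undoubledSplittings_cmFinLocalFamily`).  An
`L²`-isometric action on `𝒮(X)` is UNITARIZABLE in the algebraic sense ★ `Representation.IsUnitarizable` — the `L²` pairing `∫ Ψ Φ̄` is an invariant Hermitian
form, positive definite because a non-zero locally constant function has positive `L²`-mass for a measure charging open sets (★ `IsL2Isometric.isUnitarizable`,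
over ★ `l2NormSq_pos` ∕ `integral_mul_conj_self_eq_toReal_l2NormSq` ∕ `IsL2Isometric.integral_mul_conj_apply`).  We take the Borel σ-algebra and Mathlib's
additive Haar measure `Measure.addHaar` on `L⁺_v` (the choice of ★ `borelPlaceMeasure`); the product measure on `(L⁺_v)ⁿ′` is again a Haar measure.

* `isUnitarizable_omegaLoc_chiLocalSplittingsCM (L) (e₁) (dV hdV hdV0) (θ hθ) (hθu : θ.IsUnitary) (ε) (v) :
    ((chiLocalSplittingsCM L e₁ dV hdV hdV0 θ hθ ε).omegaLoc v).IsUnitarizable` — THE STUB U1a′.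

HONEST LABEL: HC_CM is proved only modulo the printed citations until rung 0 closes; this file closes one in-house stub of a pay-down line, no booked row.
-/

set_option autoImplicit false
-- project-wide idiom for `Summit.HodgeConjecture.HodgeConjecture.…` (summit = problem name): the namespace IS duplicated
set_option linter.dupNamespace false

noncomputable section

open NumberField IsDedekindDomain MeasureTheory
open Literature.NumberTheory Literature.NumberTheory.Automorphic Literature.NumberTheory.Automorphic.UnitaryGroup
open Literature.NumberTheory.Automorphic.Liu2021 Literature.NumberTheory.Automorphic.Liu2021.Def411WeilCarriers
open Literature.NumberTheory.Automorphic.Liu2021.Def411WeilCarriersDoubling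
open Literature.NumberTheory.GelbartRogawski1991 Literature.NumberTheory.GelbartRogawski1991.UnitaryDualPair
open Literature.NumberTheory.GelbartRogawski1991.GRConstruction
open Literature.NumberTheory.GaloisRepresentations Literature.RepresentationTheory.HarrisKudlaSweet1996
open scoped Matrix

namespace Summit.HodgeConjecture.HodgeConjecture.Cruxes.H413.F0P3bOmegaLocUnitarizable

/-- **STUB U1a′ — the local Weil representation `ω_v` of the CM splitting package `chiLocalSplittingsCM … θ …` is UNITARIZABLE at a unitary splitting
character `θ`**: Borel σ-algebra and additive Haar measure `Measure.addHaar` on `L⁺_v`; `ω_v` is `L²((L⁺_v)ⁿ′)`-isometric for `θ` unitary (★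
`isL2Isometric_omegaLoc_congrW_undoubledSplittings_cmFinLocalFamily`), hence unitarizable (★ `Representation.IsL2Isometric.isUnitarizable`: the `L²` pairing
on the Schrödinger model is an invariant positive-definite Hermitian form).
[cite: MoeglinVignerasWaldspurger1987, Chap. 2 II.1–II.2] [cite: Kudla1994, §1] [cite: GelbartRogawski1991, §3.1 Prop. 3.1.1 p. 455] -/
theorem isUnitarizable_omegaLoc_chiLocalSplittingsCM (L : Type) [Field L] [NumberField L] [IsCMField L] {n' : ℕ} (e₁ : Fin 3 × Fin 1 ≃ Fin n')
    (dV : Fin 3 → L) (hdV : ∀ i, IsCMField.complexConj L (dV i) = dV i) (hdV0 : ∀ i, dV i ≠ 0)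
    (θ : HeckeCharacter L) (hθ : IsSplittingChar L 1 θ) (hθu : θ.IsUnitary) (ε : (↥(maximalRealSubfield L))ˣ)
    (v : HeightOneSpectrum (𝓞 ↥(maximalRealSubfield L))) :
    ((chiLocalSplittingsCM L e₁ dV hdV hdV0 θ hθ ε).omegaLoc v).IsUnitarizable := by
  letI : MeasurableSpace (v.adicCompletion ↥(maximalRealSubfield L)) := borel _
  haveI : BorelSpace (v.adicCompletion ↥(maximalRealSubfield L)) := ⟨rfl⟩
  haveI := secondCountableTopology_adicCompletion (↥(maximalRealSubfield L)) v
  exact (isL2Isometric_omegaLoc_congrW_undoubledSplittings_cmFinLocalFamily L e₁ dV hdV hdV0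
    (lineW L (TW (↥(maximalRealSubfield L)) ε)) (complexConj_lineW L (TW (↥(maximalRealSubfield L)) ε))
    (lineW_ne_zero L (TW (↥(maximalRealSubfield L)) ε) (isUnit_det_TW (↥(maximalRealSubfield L)) ε)) θ hθ (borelPlaceMeasure L) v hθu
    (realDiagonal_lineW L (TW (↥(maximalRealSubfield L)) ε))
    (diagonal_lineW L (TW (↥(maximalRealSubfield L)) ε) (JW_eq (↥(maximalRealSubfield L)) L ε))
    (isSymm_TW (↥(maximalRealSubfield L)) ε) (JW_eq (↥(maximalRealSubfield L)) L ε) Measure.addHaar).isUnitarizable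

end Summit.HodgeConjecture.HodgeConjecture.Cruxes.H413.F0P3bOmegaLocUnitarizable

end
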